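import Literature.Computability.Complexity.TM2Iterate
import Mathlib.Algebra.BigOperators.Group.Finset.Basic
import HarnessLib

/-!
# Repeat a machine until it raises a flag: the loop machine with per-input running time

Trunk `CplxCore`, a TIME companion of the loop machines `TM2Iterate.lean` (clocked iteration:
the number of rounds is given in unary) and `SpaceLoop.lean` (iteration in place until a flag,
with a SPACE account). Here a bundled machine `M` over the alphabet `{0,1}` computing a string
function `F` is run repeatedly on its own output until the output starts with the flag `1`, and
what is proved is the RUNNING TIME of the whole loop on each individual input, as the sum of the
times of the rounds actually executed (Arora–Barak 2009, §1.3: machines running other machines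
as subroutines, the running time of a loop being the sum over its iterations) — the accounting
needed when the number of rounds depends on the input and only an *average* of the total time is
controlled (Levin's average polynomial time: Bogdanov–Trevisan 2006, §2.2.1, proof of Prop. 7,
"simulate `A(x; n, 1/2)`, …, `A(x; n, 2^{-k})`, … until the answer differs from `⊥`; after `k`
iterations, `A` uses time `Σᵢ p(2ⁱ n)`").

* the **orbit** of `F` on `x` (`TM2Until.fed`, `TM2Until.out`): round `0` is fed `0x`, round
  `k + 1` is fed `1s` where `0s` is the output of round `k` (flag down, state `s`); the loop ends
  at the first round whose output is `1y` (flag up), with output `y`;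
* the **loop machine** `TM2Until.untilTM M` / `TM2Until.untilAux Mx` (stacks `M.K ⊕ {IN, TMP}`,
  labels `M.Λ ⊕ Ctrl`, one symbol register; output stack = the output stack of `M`):
  `load`/`feed` bring the tagged input to `M`, the statements of `M` run unchanged on the `inl`
  stacks (`TM2Until.trStmt`, `halt ↦ test`), `test` pops the flag and either halts (`fin`: the
  rest of the output stack IS the output, in Mathlib's `haltList` convention) or pours the state
  back (`mv1`, `feed true`) for the next round;
* **`TM2Until.untilAux_outputsWithin`**: if `Mx` outputs `F u` on every `u` within `T u` steps,
  the outputs of rounds `j < J` on `x` have flag `0` and round `J` outputs `1y`, then the loop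
  machine outputs `y` on `x` within
  `2|x| + 4 + Σ_{j ≤ J} (T (fed j) + 2 |out j| + 1)` steps.

Nothing of this is in Mathlib (whose only timed `TM2` machine is the identity); the machine and
its bookkeeping (`mkStk`, one-step lemmas by `simp` from the unbundled step equations, phase
lemmas by induction on the moved list, `TM2Iter.ReachesIn` for counted runs) follow
`TM2Iterate.lean`.

## References

* S. Arora, B. Barak, *Computational Complexity: A Modern Approach*, CUP 2009, §1.3 (machine
  constructions; subroutines), §1.4.1. doi:10.1017/cbo9780511804090
* A. Bogdanov, L. Trevisan, *Average-Case Complexity*, Found. Trends TCS 2 (2006), §2.2.1,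
  Prop. 7 (proof: the doubling loop and its running time). arXiv cs/0606037v2.
* Mathlib, `Mathlib/Computability/TuringMachine/Computable.lean` (`FinTM2`, `initList`,
  `haltList`, `TM2OutputsInTime`).
-/

namespace Literature.Computability.Complexity

namespace TM2Until

open Turing StateTransition Function TM2Comp TM2Iter

/-! ### The orbit of a string function under the tagging protocol -/

section Orbit

variable (F : List Bool → List Bool) (x : List Bool)

/-- The word fed to round `k`: `0x` at round `0`, then `1s` where `0s` was the previous output
(the flag `0` is replaced by the round tag `1`). [folklore] -/
def fed : ℕ → List Bool
  | 0 => false :: x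
  | k + 1 => true :: (F (fed k)).tail

/-- The output of round `k`. [folklore] -/
def out (k : ℕ) : List Bool := F (fed F x k)

/-- Round `0` is fed `0x`. [folklore] -/
@[simp] theorem fed_zero : fed F x 0 = false :: x := rfl

/-- Round `k + 1` is fed `1 (out k).tail`. [folklore] -/
@[simp] theorem fed_succ (k : ℕ) : fed F x (k + 1) = true :: (out F x k).tail := rfl

/-- `out k = F (fed k)`. [folklore] -/
theorem out_eq (k : ℕ) : out F x k = F (fed F x k) := rfl

end Orbit

/-! ### The loop machine: auxiliary stacks, control labels, alphabets -/

/-- The two auxiliary stacks of the loop machine: the input stack `IN` and the transfer stack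
`TMP` (both over `Bool`). [folklore] -/
inductive Aux
  | IN
  | TMP
  deriving DecidableEq, Fintype

/-- The control labels of the loop machine (besides the labels of the iterated machine):
`load` (move the input onto `TMP`), `feed b` (pour `TMP` onto the input stack of the iterated
machine and push the round tag `b`), `test` (pop and inspect the flag of the output), `mv1`
(pour the rest of the output onto `TMP`), `fin` (reset the state and halt). [folklore] -/
inductive Ctrl
  | load
  | feed (b : Bool)
  | test
  | mv1
  | fin
  deriving DecidableEq, Fintype

section Machine

variable {K : Type} {G : K → Type} {Λ σ : Type}

/-- Stack alphabets of the loop machine: those of the iterated machine on `inl`, `Bool` on the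
auxiliary stacks. Written with `casesOn` so that it unfolds by `rfl` on constructors. [folklore] -/
abbrev LoopΓ (G : K → Type) : K ⊕ Aux → Type := fun j =>
  Sum.casesOn (motive := fun _ => Type) j G (fun _ => Bool)

/-- Internal states of the loop machine: a state of the iterated machine and one register for a
popped symbol (`none` between control steps). [folklore] -/
abbrev St (σ : Type) : Type := σ × Option Bool

/-- Reset the register. [folklore] -/
def rst : St σ → St σ := fun v => (v.1, none)

/-- Stack contents of the loop machine from the stacks `S` of the iterated machine and the
contents `i`, `t` of `IN`, `TMP`. [folklore] -/
def mkStk (S : ∀ k, List (G k)) (i t : List Bool) : ∀ j : K ⊕ Aux, List (LoopΓ G j)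
  | Sum.inl k => S k
  | Sum.inr Aux.IN => i
  | Sum.inr Aux.TMP => t

section StkLemmas

variable (S : ∀ k, List (G k)) (i t : List Bool)

/-- Reading a stack of the iterated machine. [folklore] -/
@[simp] theorem mkStk_inl (k : K) : mkStk S i t (Sum.inl k) = S k := rfl
/-- Reading `IN`. [folklore] -/
@[simp] theorem mkStk_IN : mkStk S i t (Sum.inr Aux.IN) = i := rfl
/-- Reading `TMP`. [folklore] -/
@[simp] theorem mkStk_TMP : mkStk S i t (Sum.inr Aux.TMP) = t := rfl

variable {dKA : DecidableEq (K ⊕ Aux)}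

/-- Writing a stack of the iterated machine (any decidability instance on `K ⊕ Aux`, so that the
lemma also fires on the instance bundled in a `FinTM2`). [folklore] -/
@[simp] theorem mkStk_update_inl [DecidableEq K] (k : K) (L : List (G k)) :
    @update _ _ dKA (mkStk S i t) (Sum.inl k) L = mkStk (update S k L) i t := by
  funext j
  rcases j with k' | a
  · rcases eq_or_ne k' k with rfl | h
    · simp
    · rw [update_of_ne (by simpa using h)]; simp [update_of_ne h]
  · rw [update_of_ne (by simp)]; cases a <;> rfl

/-- Writing `IN`. [folklore] -/
@[simp] theorem mkStk_update_IN (i' : List Bool) :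
    @update _ _ dKA (mkStk S i t) (Sum.inr Aux.IN) i' = mkStk S i' t := by
  funext j
  rcases j with k' | a
  · rw [update_of_ne (by simp)]; rfl
  · cases a
    · simp
    · rw [update_of_ne (by simp)]; rfl

/-- Writing `TMP`. [folklore] -/
@[simp] theorem mkStk_update_TMP (t' : List Bool) :
    @update _ _ dKA (mkStk S i t) (Sum.inr Aux.TMP) t' = mkStk S i t' := by
  funext j
  rcases j with k' | a
  · rw [update_of_ne (by simp)]; rfl
  · cases a
    · rw [update_of_ne (by simp)]; rfl
    · simp

/-- The empty stack assignment. [folklore] -/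
theorem mkStk_bot :
    mkStk (fun k => ([] : List (G k))) [] [] = fun j => ([] : List (LoopΓ G j)) := by
  funext j
  rcases j with k | a
  · rfl
  · cases a <;> rfl

/-- The initial stack assignment of the loop machine (input word on `IN`). [folklore] -/
theorem mkStk_bot_IN [DecidableEq K] (l : List Bool) :
    mkStk (fun k => ([] : List (G k))) l [] =
      update (fun j => ([] : List (LoopΓ G j))) (Sum.inr Aux.IN) l := by
  rw [← mkStk_bot, mkStk_update_IN]

/-- A single-stack assignment of the iterated machine, embedded. [folklore] -/
theorem mkStk_bot_inl [DecidableEq K] (k : K) (L : List (G k)) :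
    mkStk (update (fun k => ([] : List (G k))) k L) [] [] =
      update (fun j => ([] : List (LoopΓ G j))) (Sum.inl k) L := by
  rw [← mkStk_bot, mkStk_update_inl]

end StkLemmas

/-- Translation of the statements of the iterated machine: act on the `inl` stacks and the first
state component; `halt` becomes a jump to the control label `test`. [folklore] -/
def trStmt : TM2.Stmt G Λ σ → TM2.Stmt (LoopΓ G) (Λ ⊕ Ctrl) (St σ)
  | TM2.Stmt.push k f q => TM2.Stmt.push (Sum.inl k) (fun s => f s.1) (trStmt q)
  | TM2.Stmt.peek k f q => TM2.Stmt.peek (Sum.inl k) (fun s x => (f s.1 x, s.2)) (trStmt q)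
  | TM2.Stmt.pop k f q => TM2.Stmt.pop (Sum.inl k) (fun s x => (f s.1 x, s.2)) (trStmt q)
  | TM2.Stmt.load f q => TM2.Stmt.load (fun s => (f s.1, s.2)) (trStmt q)
  | TM2.Stmt.branch p q₁ q₂ => TM2.Stmt.branch (fun s => p s.1) (trStmt q₁) (trStmt q₂)
  | TM2.Stmt.goto l => TM2.Stmt.goto fun s => Sum.inl (l s.1)
  | TM2.Stmt.halt => TM2.Stmt.goto fun _ => Sum.inr Ctrl.test

/-- Configuration of the loop machine while the iterated machine runs: auxiliary stacks empty,
register reset; the halting label is sent to `test`. [folklore] -/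
def cfgM (c : TM2.Cfg G Λ σ) : TM2.Cfg (LoopΓ G) (Λ ⊕ Ctrl) (St σ) :=
  ⟨some (c.l.elim (Sum.inr Ctrl.test) Sum.inl), (c.var, none), mkStk c.stk [] []⟩

/-- One statement of the iterated machine is simulated exactly by its translation. [folklore] -/
theorem stepAux_trStmt [DecidableEq K] (q : TM2.Stmt G Λ σ) (v : σ) (S : ∀ k, List (G k)) :
    TM2.stepAux (trStmt q) ((v, none) : St σ) (mkStk S [] []) = cfgM (TM2.stepAux q v S) := by
  induction q generalizing v S with
  | push k f q ih =>
    simp only [trStmt, TM2.stepAux]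
    rw [← ih, mkStk_inl, mkStk_update_inl]
  | peek k f q ih => simp only [trStmt, TM2.stepAux]; exact ih _ _
  | pop k f q ih =>
    simp only [trStmt, TM2.stepAux]
    rw [← ih, mkStk_inl, mkStk_update_inl]
  | load f q ih => simp only [trStmt, TM2.stepAux]; exact ih _ _
  | branch p q₁ q₂ ih₁ ih₂ =>
    simp only [trStmt, TM2.stepAux]
    cases p v
    · exact ih₂ _ _
    · exact ih₁ _ _
  | goto l => rfl
  | halt => rfl

variable (k₀ k₁ : K) (eIn : G k₀ ≃ Bool) (eOut : G k₁ ≃ Bool) (main : Λ) (init : σ)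

/-- The control statements of the loop machine.
* `load`: pop the input stack `IN` symbol by symbol onto `TMP`; when `IN` is exhausted, continue
  with `feed false`;
* `feed b`: pour `TMP` onto the input stack `k₀` of the iterated machine (the second reversal
  restores the order), then push the round tag `b` on top and start the iterated machine;
* `test` (reached when the iterated machine halts, its output on `k₁`): pop the first output
  symbol, the FLAG; if it is `1` (or the output is empty) go to `fin` — the rest of `k₁` is the
  output of the loop; if it is `0`, go to `mv1`;
* `mv1`: pour `k₁` onto `TMP`, then `feed true`;
* `fin`: reset the state and halt.
[cite: AroraBarak2009, §1.3 (machines as subroutines)] -/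
def ctrlStmt : Ctrl → TM2.Stmt (LoopΓ G) (Λ ⊕ Ctrl) (St σ)
  | Ctrl.load =>
      TM2.Stmt.pop (Sum.inr Aux.IN) (fun v a => (v.1, a)) <|
        TM2.Stmt.branch (fun v => v.2.isNone)
          (TM2.Stmt.load rst <| TM2.Stmt.goto fun _ => Sum.inr (Ctrl.feed false))
          (TM2.Stmt.push (Sum.inr Aux.TMP) (fun v => v.2.getD false) <|
            TM2.Stmt.load rst <| TM2.Stmt.goto fun _ => Sum.inr Ctrl.load)
  | Ctrl.feed b =>
      TM2.Stmt.pop (Sum.inr Aux.TMP) (fun v a => (v.1, a)) <|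
        TM2.Stmt.branch (fun v => v.2.isNone)
          (TM2.Stmt.push (Sum.inl k₀) (fun _ => eIn.symm b) <| TM2.Stmt.load rst <|
            TM2.Stmt.goto fun _ => Sum.inl main)
          (TM2.Stmt.push (Sum.inl k₀) (fun v => eIn.symm (v.2.getD false)) <| TM2.Stmt.load rst <|
            TM2.Stmt.goto fun _ => Sum.inr (Ctrl.feed b))
  | Ctrl.test =>
      TM2.Stmt.pop (Sum.inl k₁) (fun v a => (v.1, a.map eOut)) <|
        TM2.Stmt.branch (fun v => v.2.isNone)
          (TM2.Stmt.load rst <| TM2.Stmt.goto fun _ => Sum.inr Ctrl.fin)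
          (TM2.Stmt.branch (fun v => v.2.getD false)
            (TM2.Stmt.load rst <| TM2.Stmt.goto fun _ => Sum.inr Ctrl.fin)
            (TM2.Stmt.load rst <| TM2.Stmt.goto fun _ => Sum.inr Ctrl.mv1))
  | Ctrl.mv1 =>
      TM2.Stmt.pop (Sum.inl k₁) (fun v a => (v.1, a.map eOut)) <|
        TM2.Stmt.branch (fun v => v.2.isNone)
          (TM2.Stmt.load rst <| TM2.Stmt.goto fun _ => Sum.inr (Ctrl.feed true))
          (TM2.Stmt.push (Sum.inr Aux.TMP) (fun v => v.2.getD false) <| TM2.Stmt.load rst <|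
            TM2.Stmt.goto fun _ => Sum.inr Ctrl.mv1)
  | Ctrl.fin => TM2.Stmt.load (fun _ => (init, none)) TM2.Stmt.halt

end Machine

/-! ### Bundling: the loop machine as a `FinTM2` -/

section Bundled

variable (M : FinTM2)

/-- Configurations of the loop machine with a reset register, from the label, the `M`-state, the
stacks of `M` and the two auxiliary stacks. [folklore] -/
def cfg (l : Option (M.Λ ⊕ Ctrl)) (v : M.σ) (S : ∀ k, List (M.Γ k)) (i t : List Bool) :
    TM2.Cfg (LoopΓ M.Γ) (M.Λ ⊕ Ctrl) (St M.σ) :=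
  ⟨l, (v, none), mkStk S i t⟩

/-- The (unbundled) type of configurations of the loop machine. [folklore] -/
abbrev LCfg : Type := TM2.Cfg (LoopΓ M.Γ) (M.Λ ⊕ Ctrl) (St M.σ)

variable (eIn : M.Γ M.k₀ ≃ Bool) (eOut : M.Γ M.k₁ ≃ Bool)

/-- **The loop machine** of a bundled TM2 machine `M` with Boolean input and output alphabets:
stacks `M.K ⊕ Aux` (input stack `inr IN`, output stack `inl k₁` — the output stack of `M`),
labels `M.Λ ⊕ Ctrl` (main label `load`), states `M.σ × Option Bool`. On input `x` it runs `M`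
on `0x`, then repeatedly on `1s` for the previous output `0s`, until an output starts with the
flag `1`; the rest of that output is the output. [cite: AroraBarak2009, §1.3 (machines as subroutines)] -/
noncomputable def untilTM : FinTM2 :=
  letI := M.kFin; letI := M.ΛFin; letI := M.σFin
  { K := M.K ⊕ Aux
    k₀ := Sum.inr Aux.IN
    k₁ := Sum.inl M.k₁
    Γ := LoopΓ M.Γ
    Λ := M.Λ ⊕ Ctrl
    main := Sum.inr Ctrl.load
    σ := St M.σ
    initialState := (M.initialState, none)
    Γk₀Fin := (inferInstance : Fintype Bool)
    m := fun l => match l with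
      | Sum.inl l => trStmt (M.m l)
      | Sum.inr c => ctrlStmt M.k₀ M.k₁ eIn eOut M.main M.initialState c }

/-- A step of the loop machine at a control label, unbundled. [folklore] -/
theorem step_inr (c : Ctrl) (var : St M.σ) (stk : ∀ j, List (LoopΓ M.Γ j)) :
    (untilTM M eIn eOut).step (⟨some (Sum.inr c), var, stk⟩ : LCfg M) =
      some (TM2.stepAux (ctrlStmt M.k₀ M.k₁ eIn eOut M.main M.initialState c) var stk) :=
  rfl

/-- A step of the loop machine at a label of the iterated machine, unbundled. [folklore] -/
theorem step_inl (l : M.Λ) (var : St M.σ) (stk : ∀ j, List (LoopΓ M.Γ j)) :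
    (untilTM M eIn eOut).step (⟨some (Sum.inl l), var, stk⟩ : LCfg M) =
      some (TM2.stepAux (trStmt (M.m l)) var stk) :=
  rfl

/-! ### Single steps of the control labels -/

section Steps

variable (v : M.σ) (S : ∀ k, List (M.Γ k)) (i t : List Bool)

/-- `load` on a nonempty input stack: the symbol goes to `TMP`. [folklore] -/
theorem step_load_cons (s : Bool) :
    (untilTM M eIn eOut).step (cfg M (some (Sum.inr Ctrl.load)) v S (s :: i) t) =
      some (cfg M (some (Sum.inr Ctrl.load)) v S i (s :: t)) := by
  rw [cfg, step_inr]; simp [ctrlStmt, rst, cfg]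

/-- `load` on an empty input stack: proceed to `feed false`. [folklore] -/
theorem step_load_nil :
    (untilTM M eIn eOut).step (cfg M (some (Sum.inr Ctrl.load)) v S [] t) =
      some (cfg M (some (Sum.inr (Ctrl.feed false))) v S [] t) := by
  rw [cfg, step_inr]; simp [ctrlStmt, rst, cfg]

/-- `feed b` on nonempty `TMP`: move one symbol to `k₀` (through `eIn.symm`). [folklore] -/
theorem step_feed_cons (b s : Bool) :
    (untilTM M eIn eOut).step (cfg M (some (Sum.inr (Ctrl.feed b))) v S i (s :: t)) =
      some (cfg M (some (Sum.inr (Ctrl.feed b))) v (update S M.k₀ (eIn.symm s :: S M.k₀)) i t) := by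
  rw [cfg, step_inr]; simp [ctrlStmt, rst, cfg]

/-- `feed b` on empty `TMP`: push the tag `b` on `k₀` and start the iterated machine. [folklore] -/
theorem step_feed_nil (b : Bool) :
    (untilTM M eIn eOut).step (cfg M (some (Sum.inr (Ctrl.feed b))) v S i []) =
      some (cfg M (some (Sum.inl M.main)) v (update S M.k₀ (eIn.symm b :: S M.k₀)) i []) := by
  rw [cfg, step_inr]; simp [ctrlStmt, rst, cfg]

/-- `test` on an output flagged `1`: pop the flag and go to `fin`. [folklore] -/
theorem step_test_true (L : List (M.Γ M.k₁)) :
    (untilTM M eIn eOut).step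
        (cfg M (some (Sum.inr Ctrl.test)) v (update S M.k₁ (eOut.symm true :: L)) i t) =
      some (cfg M (some (Sum.inr Ctrl.fin)) v (update S M.k₁ L) i t) := by
  rw [cfg, step_inr]; simp [ctrlStmt, rst, cfg]

/-- `test` on an output flagged `0`: pop the flag and go to `mv1`. [folklore] -/
theorem step_test_false (L : List (M.Γ M.k₁)) :
    (untilTM M eIn eOut).step
        (cfg M (some (Sum.inr Ctrl.test)) v (update S M.k₁ (eOut.symm false :: L)) i t) =
      some (cfg M (some (Sum.inr Ctrl.mv1)) v (update S M.k₁ L) i t) := by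
  rw [cfg, step_inr]; simp [ctrlStmt, rst, cfg]

/-- `mv1` on nonempty `k₁`: move one symbol to `TMP` (through `eOut`). [folklore] -/
theorem step_mv1_cons (g : M.Γ M.k₁) (L : List (M.Γ M.k₁)) :
    (untilTM M eIn eOut).step (cfg M (some (Sum.inr Ctrl.mv1)) v (update S M.k₁ (g :: L)) i t) =
      some (cfg M (some (Sum.inr Ctrl.mv1)) v (update S M.k₁ L) i (eOut g :: t)) := by
  rw [cfg, step_inr]; simp [ctrlStmt, rst, cfg]

/-- `mv1` on empty `k₁`: proceed to `feed true`. [folklore] -/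
theorem step_mv1_nil :
    (untilTM M eIn eOut).step (cfg M (some (Sum.inr Ctrl.mv1)) v (update S M.k₁ []) i t) =
      some (cfg M (some (Sum.inr (Ctrl.feed true))) v (update S M.k₁ []) i t) := by
  rw [cfg, step_inr]; simp [ctrlStmt, rst, cfg]

/-- `fin`: reset the state and halt. [folklore] -/
theorem step_fin :
    (untilTM M eIn eOut).step (cfg M (some (Sum.inr Ctrl.fin)) v S i t) =
      some (cfg M none M.initialState S i t) := by
  rw [cfg, step_inr]; simp [ctrlStmt, cfg]

/-- A step of the iterated machine `M` is a step of the loop machine on the embedded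
configuration. [folklore] -/
theorem step_cfgM (a b : M.Cfg) (h : M.step a = some b) :
    (untilTM M eIn eOut).step (cfgM a) = some (cfgM b) := by
  obtain ⟨_ | l, w, S'⟩ := a
  · simp [FinTM2.step, TM2.step] at h
  · simp only [FinTM2.step, TM2.step] at h
    obtain rfl := Option.some.inj h
    simp only [cfgM, Option.elim]
    rw [step_inl, stepAux_trStmt]
    rfl

end Steps

/-! ### Phases of the loop machine -/

section Phases

variable (v : M.σ) (S : ∀ k, List (M.Γ k))

/-- `load`: the input `i` is moved (reversed) onto `TMP`, then the machine proceeds to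
`feed false`; `|i| + 1` steps. [folklore] -/
theorem load_run (t : List Bool) : ∀ i : List Bool,
    ReachesIn (C := LCfg M) (untilTM M eIn eOut).step
      (cfg M (some (Sum.inr Ctrl.load)) v S i t)
      (cfg M (some (Sum.inr (Ctrl.feed false))) v S [] (i.reverse ++ t)) (i.length + 1) := by
  intro i
  induction i generalizing t with
  | nil => simpa using ReachesIn.single (step_load_nil M eIn eOut v S t)
  | cons s i ih =>
    simpa [List.append_assoc] using
      ReachesIn.step_trans (step_load_cons M eIn eOut v S i t s) (ih (s :: t))

/-- `feed b`: `TMP` is moved (reversed, written through `eIn.symm`) on top of the input stack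
`k₀` of `M`, then the tag `b` is pushed and the machine jumps to the main label of `M`;
`|t| + 1` steps. [folklore] -/
theorem feed_run (b : Bool) (i : List Bool) : ∀ (t : List Bool) (S : ∀ k, List (M.Γ k)),
    ReachesIn (C := LCfg M) (untilTM M eIn eOut).step
      (cfg M (some (Sum.inr (Ctrl.feed b))) v S i t)
      (cfg M (some (Sum.inl M.main)) v
        (update S M.k₀ (eIn.symm b :: (t.reverse.map eIn.symm ++ S M.k₀))) i []) (t.length + 1) := by
  intro t
  induction t with
  | nil =>
    intro S
    simpa using ReachesIn.single (step_feed_nil M eIn eOut v S i b)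
  | cons s t ih =>
    intro S
    have h1 := ih (update S M.k₀ (eIn.symm s :: S M.k₀))
    simp only [update_idem, update_self] at h1
    simpa [List.append_assoc] using
      ReachesIn.step_trans (step_feed_cons M eIn eOut v S i t b s) h1

/-- `mv1`: the output stack `k₁` of `M` is moved (reversed, read through `eOut`) onto `TMP`, then
the machine proceeds to `feed true`; `|L| + 1` steps. [folklore] -/
theorem mv1_run (i : List Bool) : ∀ (L : List (M.Γ M.k₁)) (t : List Bool),
    ReachesIn (C := LCfg M) (untilTM M eIn eOut).step
      (cfg M (some (Sum.inr Ctrl.mv1)) v (update S M.k₁ L) i t)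
      (cfg M (some (Sum.inr (Ctrl.feed true))) v (update S M.k₁ []) i (L.reverse.map eOut ++ t))
      (L.length + 1) := by
  intro L
  induction L with
  | nil =>
    intro t
    simpa using ReachesIn.single (step_mv1_nil M eIn eOut v S i t)
  | cons g L ih =>
    intro t
    simpa [List.append_assoc] using
      ReachesIn.step_trans (step_mv1_cons M eIn eOut v S i t g L) (ih (eOut g :: t))

/-- A run of the iterated machine `M` is a run of the loop machine on embedded configurations.
[folklore] -/
theorem run_cfgM {n : ℕ} {a b : M.Cfg} (h : (flip bind M.step)^[n] (some a) = some b) :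
    (flip bind (untilTM M eIn eOut).step)^[n] (some (cfgM a)) = some (cfgM b) :=
  iterate_bind_map M.step (untilTM M eIn eOut).step cfgM
    (fun x y hxy => step_cfgM M eIn eOut x y hxy) n a b h

/-- The empty stack assignment of `M`. [folklore] -/
abbrev botStk : ∀ k, List (M.Γ k) := fun _ => []

/-- The initial configuration of the loop machine. [folklore] -/
theorem initList_untilTM (l : List Bool) :
    initList (untilTM M eIn eOut) l =
      cfg M (some (Sum.inr Ctrl.load)) M.initialState (botStk M) l [] := by
  rw [initList_eq]
  change (⟨some (Sum.inr Ctrl.load), (M.initialState, none),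
      update (fun j => ([] : List (LoopΓ M.Γ j))) (Sum.inr Aux.IN) l⟩ : LCfg M) = _
  rw [← mkStk_bot_IN]
  rfl

/-- The halting configuration of the loop machine: output on the output stack of `M`. [folklore] -/
theorem haltList_untilTM (L : List (M.Γ M.k₁)) :
    haltList (untilTM M eIn eOut) L = cfg M none M.initialState (update (botStk M) M.k₁ L) [] [] := by
  rw [haltList_eq]
  change (⟨none, (M.initialState, none),
      update (fun j => ([] : List (LoopΓ M.Γ j))) (Sum.inl M.k₁) L⟩ : LCfg M) = _
  rw [← mkStk_bot_inl]
  rfl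

/-- The embedded initial configuration of `M` on input `l`. [folklore] -/
theorem cfgM_initList (l : List (M.Γ M.k₀)) :
    cfgM (initList M l) = cfg M (some (Sum.inl M.main)) M.initialState (update (botStk M) M.k₀ l) [] [] := by
  rw [initList_eq]; rfl

/-- The embedded halting configuration of `M` with output `L`: the loop machine is at `test`.
[folklore] -/
theorem cfgM_haltList (L : List (M.Γ M.k₁)) :
    cfgM (haltList M L) = cfg M (some (Sum.inr Ctrl.test)) M.initialState (update (botStk M) M.k₁ L) [] [] := by
  rw [haltList_eq]; rfl

/-- **Starting.** From the initial configuration on `x` the loop machine reaches the embedded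
start of `M` on `0x` within `2|x| + 2` steps (`load`, then `feed false`). [folklore] -/
theorem start_run (x : List Bool) :
    ReachesIn (C := LCfg M) (untilTM M eIn eOut).step (initList (untilTM M eIn eOut) x)
      (cfgM (initList M ((false :: x).map eIn.symm))) (2 * x.length + 2) := by
  rw [initList_untilTM, cfgM_initList]
  have h1 := load_run M eIn eOut M.initialState (botStk M) [] x
  have h2 := feed_run M eIn eOut M.initialState false [] (x.reverse ++ []) (botStk M)
  simp only [List.append_nil, List.reverse_reverse, List.length_reverse, List.map_cons] at h1 h2 ⊢
  refine ((h1.trans h2).mono ?_)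
  omega

/-- **One round, continuing.** If `M` maps the word `u` to an output `0s` (flag down) within `m`
steps, then from the embedded start of `M` on `u` the loop machine reaches the embedded start of
`M` on `1s` within `m + 2|s| + 3` steps (run, `test`, `mv1`, `feed true`). [folklore] -/
theorem round_continue (u s : List Bool) {m : ℕ}
    (h : ReachesIn M.step (initList M (u.map eIn.symm)) (haltList M ((false :: s).map eOut.symm)) m) :
    ReachesIn (C := LCfg M) (untilTM M eIn eOut).step (cfgM (initList M (u.map eIn.symm)))
      (cfgM (initList M ((true :: s).map eIn.symm))) (m + 2 * s.length + 3) := by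
  obtain ⟨n, hn, e⟩ := h
  -- the run of `M`, ending at `test` with the output `0 s` on `k₁`
  have h1 : ReachesIn (C := LCfg M) (untilTM M eIn eOut).step (cfgM (initList M (u.map eIn.symm)))
      (cfgM (haltList M ((false :: s).map eOut.symm))) m := ⟨n, hn, run_cfgM M eIn eOut e⟩
  rw [cfgM_haltList, List.map_cons] at h1
  -- `test`: flag down, go to `mv1`
  have h2 := ReachesIn.single (step_test_false M eIn eOut M.initialState (botStk M) [] [] (s.map eOut.symm))
  -- `mv1`: `k₁` to `TMP`
  have h3 := mv1_run M eIn eOut M.initialState (botStk M) [] (s.map eOut.symm) []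
  have hs : (s.map eOut.symm).reverse.map eOut ++ [] = s.reverse := by simp [List.map_reverse]
  -- emptying an empty stack (cf. `SpaceLoop.update_botStk_nil`)
  have hbot : update (botStk M) M.k₁ [] = botStk M := by
    funext j; by_cases h : j = M.k₁
    · subst h; simp
    · simp [update_of_ne h]
  rw [hs, List.length_map, hbot] at h3
  -- `feed true`: `TMP` to `k₀`, tag `1`
  have h4 := feed_run M eIn eOut M.initialState true [] s.reverse (botStk M)
  rw [List.reverse_reverse, List.length_reverse] at h4
  have hend : cfgM (initList M ((true :: s).map eIn.symm)) = cfg M (some (Sum.inl M.main)) M.initialState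
      (update (botStk M) M.k₀ (eIn.symm true :: (s.map eIn.symm ++ botStk M M.k₀))) [] [] := by
    rw [cfgM_initList]
    simp
  rw [hend]
  refine (((h1.trans h2).trans h3).trans h4).mono ?_
  omega

/-- **One round, halting.** If `M` maps the word `u` to an output `1y` (flag up) within `m`
steps, then from the embedded start of `M` on `u` the loop machine halts with output `y` within
`m + 2` steps (run, `test`, `fin`). [folklore] -/
theorem round_halt (u y : List Bool) {m : ℕ}
    (h : ReachesIn M.step (initList M (u.map eIn.symm)) (haltList M ((true :: y).map eOut.symm)) m) :
    ReachesIn (C := LCfg M) (untilTM M eIn eOut).step (cfgM (initList M (u.map eIn.symm)))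
      (haltList (untilTM M eIn eOut) (y.map eOut.symm)) (m + 2) := by
  obtain ⟨n, hn, e⟩ := h
  have h1 : ReachesIn (C := LCfg M) (untilTM M eIn eOut).step (cfgM (initList M (u.map eIn.symm)))
      (cfgM (haltList M ((true :: y).map eOut.symm))) m := ⟨n, hn, run_cfgM M eIn eOut e⟩
  rw [cfgM_haltList, List.map_cons] at h1
  have h2 := ReachesIn.single (step_test_true M eIn eOut M.initialState (botStk M) [] [] (y.map eOut.symm))
  have h3 := ReachesIn.single (step_fin M eIn eOut M.initialState (update (botStk M) M.k₁ (y.map eOut.symm)) [] [])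
  rw [haltList_untilTM]
  exact (h1.trans h2).trans h3

end Phases

end Bundled

/-! ### The loop machine computes the orbit until the flag, in the sum of the round times -/

section Main

open Finset

variable (Mx : TM2ComputableAux Bool Bool) {F : List Bool → List Bool} {T : List Bool → ℕ}
  (hF : ∀ u, Mx.OutputsWithin u (F u) (T u))

/-- The loop machine of `Mx : TM2ComputableAux Bool Bool`, as a machine with input and output
alphabet `Bool`. [folklore] -/
noncomputable def untilAux : TM2ComputableAux Bool Bool :=
  ⟨untilTM Mx.tm Mx.inputAlphabet Mx.outputAlphabet, Equiv.refl _, Mx.outputAlphabet⟩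

/-- The cost of round `j` of the orbit of `F` on `x`: the time of `Mx` on the fed word, plus the
pouring of the output. [folklore] -/
def roundCost (F : List Bool → List Bool) (T : List Bool → ℕ) (x : List Bool) (j : ℕ) : ℕ :=
  T (fed F x j) + 2 * (out F x j).length + 1

include hF in
/-- **The main loop.** If the outputs of rounds `j, …, j + d - 1` on `x` have flag `0` and round
`j + d` outputs `1y`, then from the embedded start of round `j` the loop machine halts with output
`y` within `Σ_{i ∈ [j, j+d]} roundCost i + 1` steps. [folklore] -/
theorem loop_run (x y : List Bool) : ∀ (d j : ℕ),
    (∀ i, j ≤ i → i < j + d → ∃ s, out F x i = false :: s) → out F x (j + d) = true :: y →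
    ReachesIn (C := LCfg Mx.tm) (untilTM Mx.tm Mx.inputAlphabet Mx.outputAlphabet).step
      (cfgM (initList Mx.tm ((fed F x j).map Mx.inputAlphabet.symm)))
      (haltList (untilTM Mx.tm Mx.inputAlphabet Mx.outputAlphabet) (y.map Mx.outputAlphabet.symm))
      (∑ i ∈ range (d + 1), roundCost F T x (j + i) + 1) := by
  intro d
  induction d with
  | zero =>
    intro j _ hhalt
    rw [Nat.add_zero] at hhalt
    have h := round_halt Mx.tm Mx.inputAlphabet Mx.outputAlphabet (fed F x j) y
      (by
        have := reachesIn_of_outputsWithin Mx (hF (fed F x j))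
        rw [← out_eq F x j, hhalt] at this
        exact this)
    refine h.mono ?_
    simp [roundCost]
  | succ d ih =>
    intro j hcont hhalt
    obtain ⟨s, hs⟩ := hcont j le_rfl (by omega)
    have h1 := round_continue Mx.tm Mx.inputAlphabet Mx.outputAlphabet (fed F x j) s
      (by
        have := reachesIn_of_outputsWithin Mx (hF (fed F x j))
        rw [← out_eq F x j, hs] at this
        exact this)
    have hfed : fed F x (j + 1) = true :: s := by rw [fed_succ, hs]; rfl
    rw [← hfed] at h1
    have h2 := ih (j + 1) (fun i hi hi' => hcont i (by omega) (by omega)) (by rw [show j + 1 + d = j + (d + 1) by omega]; exact hhalt)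
    refine (h1.trans h2).mono ?_
    rw [Finset.sum_range_succ' _ (d + 1)]
    have e : ∀ i, j + 1 + i = j + (i + 1) := fun i => by omega
    simp only [e, Nat.add_zero]
    have hlen : (out F x j).length = s.length + 1 := by rw [hs]; rfl
    simp only [roundCost, hlen]
    omega

include hF in
/-- **Correctness and running time of the loop machine, per input.** If `Mx` outputs `F u` on
every input `u` within `T u` steps, the outputs of the rounds `j < J` of the orbit of `F` on `x`
have flag `0`, and round `J` outputs `1y`, then the loop machine `untilAux Mx` outputs `y` on `x`
within `2|x| + 3 + Σ_{j ≤ J} (T (fed j) + 2 |out j| + 1)` steps.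
[cite: AroraBarak2009, §1.3 (machines as subroutines; the time of a loop is the sum over its iterations)] -/
theorem untilAux_outputsWithin (x : List Bool) (J : ℕ) (y : List Bool)
    (hcont : ∀ j < J, ∃ s, out F x j = false :: s) (hhalt : out F x J = true :: y) :
    (untilAux Mx).OutputsWithin x y
      (2 * x.length + 3 + ∑ j ∈ range (J + 1), roundCost F T x j) := by
  apply outputsWithin_of_reachesIn
  have hin : x.map (untilAux Mx).inputAlphabet.symm = x := List.map_id _
  rw [hin]
  change ReachesIn (C := LCfg Mx.tm) (untilTM Mx.tm Mx.inputAlphabet Mx.outputAlphabet).step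
    (initList (untilTM Mx.tm Mx.inputAlphabet Mx.outputAlphabet) x)
    (haltList (untilTM Mx.tm Mx.inputAlphabet Mx.outputAlphabet) (y.map Mx.outputAlphabet.symm)) _
  have h1 := start_run Mx.tm Mx.inputAlphabet Mx.outputAlphabet x
  have h2 := loop_run Mx hF x y J 0 (fun i _ hi => hcont i (by omega)) (by rw [Nat.zero_add]; exact hhalt)
  simp only [Nat.zero_add] at h2
  rw [← fed_zero F x] at h1
  refine (h1.trans h2).mono ?_
  omega

end Main

end TM2Until

end Literature.Computability.Complexity
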